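import Summits.CriticalPhenomena.PercolationContinuityZ3.Theorems.Transplant.FKDoubleFanMultifanCone
import Summits.CriticalPhenomena.PercolationContinuityZ3.Theorems.Transplant.FKDoubleFanTwoSidedConeSCrossA
import HarnessLib

/-!
# Double fans `K₂ ∨ P_{m+1}`: the EXACT local criterion for `HypAC` — cross-positivity of the diagonal operator `T_a` on the MULTIFAN₁ cone

Helper file (`--supports stmt-CriticalPhenomena-4575`), FK sub-lane `prim-bschramm-fk-3` (gen 44); builds on p205010 (kernel theorem, internal
audit signed; external expert review pending).  No named facts, no sorries; standard axioms.  Memo `bschramm/prim-bschramm-fk-3/FAR-CROSS-XIX.md` §2.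

`…MultifanCone` reduces the far cross-apex theorem for all middles to `HypAC q`: `∧²AC_x` maps every MULTIFAN₁ image `imgAB q F G u` into the
MULTIFAN₁ cone `coneAB q` (bi-dual `DualAB q`).  Since `∧²AC_x = (1−x)²·exp(s·T_a)` (`eˢ = 1/(1−x)`) with the DIAGONAL operator `T_a` (Plücker
weights `0` on `ux,uz,xz`, `1` on `uy,uv,xy,xv,yz,zv`, `2` on `yv`), `A`-stability of the closed convex cone is EQUIVALENT to CROSS-POSITIVITY of `T_a`
(Schneider–Vidyasagar); the abstract `T_a`-resolvent machinery (`scaleTa`, `res_sub_opTa`, `pdualA_of_sub/res/res_pow/exp`, `pdual_opAC`) is the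
one of `…TwoSidedConeSCrossA` (gen 41), instantiated here with a new compact generating set: **`atomClosureAB q`** (closure
in `ℝ¹⁰` of the normalised non-zero MULTIFAN₁ images over `InKE³`; compact; its half-space dual is `DualAB q`, **`dualAB_iff_atomClosureAB`**);
**`hypAC_of_crossPosA`** (`0 < q ≤ 1`: a functional `e₀` with `c·‖imgAB‖ ≤ ⟪imgAB, e₀⟫`, `c > 0`, plus cross-positivity of `T_a` on `atomClosureAB q`
⟹ `HypAC q`, hence the far cross-apex theorem for all middles by `negCorr_spokes_cross_far_of_hypAC`); **`crossPosA_of_hypAC`** (the criterion is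
exact).  The positivity functional is expected to be `e₀ = e_uv + e_xv + e_yv + e_zv` (`ℓ`), for which `‖imgAB‖∞ ≤ ℓ(imgAB)` holds in every exact
sample of the memo (§2g; the product-form certificates of `…TwoSidedSignsBCert*` type are the next file) — it enters here only as a hypothesis.
Use (memo §2): a certificate at a generator `g = imgAB F G u` may contain a free multiple of `g`, every derivative `∂ imgAB` along feasible curves
in `InKE³` (in particular the letter moves `F ↦ BC_ε∗F`, `F ↦ E_{1−ε}F`, `G ↦ BC_ε∗G`, `G ↦ E_{1−ε}G`, `u ↦ letter∗u`), and genuine atoms.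
[folklore]
-/

noncomputable section

open Filter Topology

namespace Summit.CriticalPhenomena.PercolationContinuityZ3.Theorems

namespace FK

namespace ThreeApex

/-! ### The instantiation: normalised MULTIFAN₁ images in `ℝ¹⁰` -/

/-- The set of normalised non-zero MULTIFAN₁ images `imgAB q F G u`, `F, G, u ∈ InKE q`, as coordinate vectors. [folklore] -/
def atomSetAB (q : ℝ) : Set (Fin 10 → ℝ) :=
  {v | ∃ F G u : V5, InKE q F ∧ InKE q G ∧ InKE q u ∧ Biv.toFun (imgAB q F G u) ≠ 0 ∧
    v = ‖Biv.toFun (imgAB q F G u)‖⁻¹ • Biv.toFun (imgAB q F G u)}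

/-- **The compact generating set** of the MULTIFAN₁ cone: the closure of the normalised MULTIFAN₁ images. [folklore] -/
def atomClosureAB (q : ℝ) : Set (Fin 10 → ℝ) := closure (atomSetAB q)

/-- Normalised atoms lie in the closed unit ball. [folklore] -/
theorem atomSetAB_subset_closedBall (q : ℝ) : atomSetAB q ⊆ Metric.closedBall 0 1 := by
  rintro v ⟨F, G, u, -, -, -, hne, rfl⟩
  rw [Metric.mem_closedBall, dist_zero_right, norm_smul, norm_inv, norm_norm, inv_mul_cancel₀ (norm_ne_zero_iff.2 hne)]

/-- `atomClosureAB q` is compact. [folklore] -/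
theorem isCompact_atomClosureAB (q : ℝ) : IsCompact (atomClosureAB q) :=
  (isCompact_closedBall (0 : Fin 10 → ℝ) 1).of_isClosed_subset isClosed_closure
    (closure_minimal (atomSetAB_subset_closedBall q) Metric.isClosed_closedBall)

/-- A non-zero atom: the input frame of `δ₀`. [folklore] -/
theorem atomSetAB_nonempty (q : ℝ) : (atomSetAB q).Nonempty := by
  have hne : Biv.toFun (imgAB q fanInit fanInit delta0) ≠ 0 := by
    intro h
    have h1 : Biv.toFun (imgAB q fanInit fanInit delta0) 1 = 0 := by rw [h]; rfl
    rw [imgAB_init] at h1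
    simp [Biv.toFun, wedgeH, conv, edgeAC, delta0, hy, V5.total] at h1
  exact ⟨_, fanInit, fanInit, delta0, fanInit_inKE q, fanInit_inKE q, InKE.base, hne, rfl⟩

/-- `atomClosureAB q` is nonempty. [folklore] -/
theorem atomClosureAB_nonempty (q : ℝ) : (atomClosureAB q).Nonempty :=
  (atomSetAB_nonempty q).mono subset_closure

/-- A closed half-space condition that holds on the atoms holds on the closure. [folklore] -/
theorem atomClosureAB_le_of_atoms {q : ℝ} {ρ : Biv} {c : ℝ}
    (h : ∀ F G u : V5, InKE q F → InKE q G → InKE q u → c * ‖Biv.toFun (imgAB q F G u)‖ ≤ pairH q (imgAB q F G u) ρ) :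
    ∀ v ∈ atomClosureAB q, c ≤ pairH q (Biv.ofFun v) ρ := by
  have hcl : IsClosed {v : Fin 10 → ℝ | c ≤ pairH q (Biv.ofFun v) ρ} := isClosed_le continuous_const (continuous_pairH_ofFun q ρ)
  refine fun v hv => closure_minimal ?_ hcl hv
  rintro v ⟨F, G, u, hF, hG, hu, hne, rfl⟩
  have hn : 0 < ‖Biv.toFun (imgAB q F G u)‖ := norm_pos_iff.2 hne
  show c ≤ pairH q (Biv.ofFun (‖Biv.toFun (imgAB q F G u)‖⁻¹ • Biv.toFun (imgAB q F G u))) ρ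
  rw [Biv.ofFun_smul, pairH_smul_left, Biv.ofFun_toFun, le_inv_mul_iff₀ hn]
  simpa [mul_comm] using h F G u hF hG hu

/-- **The half-space dual of `atomClosureAB q` is `DualAB q`.** [folklore] -/
theorem dualAB_iff_atomClosureAB (q : ℝ) (ρ : Biv) :
    DualAB q ρ ↔ PDual q (atomClosureAB q) (fun v => Biv.ofFun v) ρ := by
  constructor
  · intro hρ v hv
    have := atomClosureAB_le_of_atoms (q := q) (ρ := ρ) (c := 0) (fun F G u hF hG hu => by simpa using hρ F G u hF hG hu) v hv
    simpa using this
  · intro h F G u hF hG hu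
    by_cases hne : Biv.toFun (imgAB q F G u) = 0
    · have e : imgAB q F G u = Biv.ofFun 0 := by rw [← hne, Biv.ofFun_toFun]
      rw [e, pairH_ofFun_zero]
    · have hn : 0 < ‖Biv.toFun (imgAB q F G u)‖ := norm_pos_iff.2 hne
      have hv : ‖Biv.toFun (imgAB q F G u)‖⁻¹ • Biv.toFun (imgAB q F G u) ∈ atomClosureAB q :=
        subset_closure ⟨F, G, u, hF, hG, hu, hne, rfl⟩
      have := h _ hv
      dsimp only at this
      rw [Biv.ofFun_smul, pairH_smul_left, Biv.ofFun_toFun] at this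
      exact (mul_nonneg_iff_of_pos_left (inv_pos.2 hn)).1 this

/-- Points of the closure lie in the (closed) cone `coneAB q`. [folklore] -/
theorem ofFun_mem_coneAB_of_mem_atomClosureAB {q : ℝ} {v : Fin 10 → ℝ} (hv : v ∈ atomClosureAB q) : Biv.ofFun v ∈ coneAB q :=
  fun γ hγ => (dualAB_iff_atomClosureAB q γ).1 hγ v hv

/-- **The full spoke `x = 1` by continuity**: if `∧²AC_x β ∈ coneAB` for all `x ∈ [0,1)`, then `∧²AC_1 β ∈ coneAB`. [folklore] -/
theorem opAC_one_mem_coneAB_of_lt {q : ℝ} {β : Biv} (hβ : ∀ x : ℝ, 0 ≤ x → x < 1 → opAC x β ∈ coneAB q) :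
    opAC 1 β ∈ coneAB q := by
  intro γ hγ
  set g : ℝ → ℝ := fun x => (1 - x) ^ 2 * pairH q β γ + x * (1 - x) * pairH q (opTa β) γ + x ^ 2 * pairH q (opWa β) γ with hg
  have hcont : Continuous g := by rw [hg]; continuity
  have hlim : Tendsto g (𝓝[<] (1 : ℝ)) (𝓝 (g 1)) := (hcont.tendsto 1).mono_left nhdsWithin_le_nhds
  have hev : ∀ᶠ x in 𝓝[<] (1 : ℝ), 0 ≤ g x := by
    filter_upwards [Ioo_mem_nhdsLT (zero_lt_one' ℝ)] with x hx
    rw [hg]; dsimp only; rw [← pairH_opAC_poly]; exact hβ x hx.1.le hx.2 γ hγ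
  have := ge_of_tendsto hlim hev
  rw [hg] at this; dsimp only at this
  rwa [pairH_opAC_poly]

/-! ### The exact criterion -/

/-- **`HypAC` from cross-positivity of `T_a`** (`0 < q ≤ 1`): if some functional `e₀` is uniformly positive on the MULTIFAN₁ images
(`c·‖imgAB‖ ≤ ⟪imgAB, e₀⟫`, `c > 0`) and `⟪T_a β, ρ⟫ ≥ 0` for every `β` in the closure of the normalised images and every `ρ ∈ DualAB q` with
`⟪β, ρ⟫ = 0`, then `HypAC q` — and with it (`negCorr_spokes_cross_far_of_hypAC`) the far cross-apex theorem for all middles. [folklore] -/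
theorem hypAC_of_crossPosA {q : ℝ} (e₀ : Biv) {c : ℝ} (hc : 0 < c)
    (hpos : ∀ F G u : V5, InKE q F → InKE q G → InKE q u → c * ‖Biv.toFun (imgAB q F G u)‖ ≤ pairH q (imgAB q F G u) e₀)
    (hcross : ∀ v ∈ atomClosureAB q, ∀ ρ : Biv, DualAB q ρ → pairH q (Biv.ofFun v) ρ = 0 → 0 ≤ pairH q (opTa (Biv.ofFun v)) ρ) :
    HypAC q := by
  set P := atomClosureAB q
  set α : (Fin 10 → ℝ) → Biv := fun v => Biv.ofFun v
  have hPc : IsCompact P := isCompact_atomClosureAB q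
  have hPn : P.Nonempty := atomClosureAB_nonempty q
  have hec : ∀ v ∈ P, c ≤ pairH q (α v) e₀ := atomClosureAB_le_of_atoms hpos
  have he : ∀ v ∈ P, 0 < pairH q (α v) e₀ := fun v hv => lt_of_lt_of_le hc (hec v hv)
  have hcont : ∀ ρ : Biv, ContinuousOn (fun v => pairH q (α v) ρ) P := fun ρ => (continuous_pairH_ofFun q ρ).continuousOn
  have hcontq : ∀ ρ : Biv, ContinuousOn (fun v => pairH q (α v) ρ / pairH q (α v) e₀) P :=
    fun ρ => (hcont ρ).div (hcont e₀) fun v hv => (he v hv).ne'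
  obtain ⟨vM, hvM, hmax⟩ := hPc.exists_isMaxOn hPn (hcontq (opTa e₀))
  set M : ℝ := max (pairH q (α vM) (opTa e₀) / pairH q (α vM) e₀) 1 with hMdef
  have hM0 : 0 < M := lt_of_lt_of_le zero_lt_one (le_max_right _ _)
  have hM : ∀ v ∈ P, pairH q (α v) (opTa e₀) ≤ M * pairH q (α v) e₀ :=
    fun v hv => (div_le_iff₀ (he v hv)).1 (le_trans (hmax hv) (le_max_left _ _))
  have hmin : ∀ ρ : Biv, (∃ x ∈ P, pairH q (α x) ρ < 0) →
      ∃ x₀ ∈ P, ∀ x ∈ P, pairH q (α x₀) ρ * pairH q (α x) e₀ ≤ pairH q (α x) ρ * pairH q (α x₀) e₀ := by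
    intro ρ _
    obtain ⟨x₀, hx₀, hmin⟩ := hPc.exists_isMinOn hPn (hcontq ρ)
    exact ⟨x₀, hx₀, fun x hx => (div_le_div_iff₀ (he x₀ hx₀) (he x hx)).1 (hmin hx)⟩
  have hcross' : ∀ x ∈ P, ∀ ρ : Biv, PDual q P α ρ → pairH q (α x) ρ = 0 → 0 ≤ pairH q (opTa (α x)) ρ :=
    fun x hx ρ hρ h0 => hcross x hx ρ ((dualAB_iff_atomClosureAB q ρ).2 hρ) h0
  have hdual : ∀ ρ : Biv, DualAB q ρ → ∀ x : ℝ, 0 ≤ x → x < 1 → DualAB q (opAC x ρ) := by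
    intro ρ hρ x hx0 hx1
    exact (dualAB_iff_atomClosureAB q _).2
      (pdual_opAC he hM hmin hcross' hM0 hx0 hx1 ((dualAB_iff_atomClosureAB q ρ).1 hρ))
  have hlt : ∀ F G u : V5, InKE q F → InKE q G → InKE q u → ∀ x : ℝ, 0 ≤ x → x < 1 → opAC x (imgAB q F G u) ∈ coneAB q := by
    intro F G u hF hG hu x hx0 hx1 ρ hρ
    rw [pairH_opAC]
    exact hdual ρ hρ x hx0 hx1 F G u hF hG hu
  intro F G u x hF hG hu hx0 hx1
  rcases lt_or_eq_of_le hx1 with h | rfl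
  · exact hlt F G u hF hG hu x hx0 h
  · exact opAC_one_mem_coneAB_of_lt fun x' hx'0 hx'1 => hlt F G u hF hG hu x' hx'0 hx'1

/-- **The criterion is exact**: `HypAC q` implies cross-positivity of `T_a` on the closure of the normalised MULTIFAN₁ images. [folklore] -/
theorem crossPosA_of_hypAC {q : ℝ} (hA : HypAC q) :
    ∀ v ∈ atomClosureAB q, ∀ ρ : Biv, DualAB q ρ → pairH q (Biv.ofFun v) ρ = 0 → 0 ≤ pairH q (opTa (Biv.ofFun v)) ρ := by
  intro v hv ρ hρ h0
  set β := Biv.ofFun v with hβ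
  have hβK : β ∈ coneAB q := ofFun_mem_coneAB_of_mem_atomClosureAB hv
  have hg : ∀ x : ℝ, 0 ≤ x → x ≤ 1 → 0 ≤ x * (1 - x) * pairH q (opTa β) ρ + x ^ 2 * pairH q (opWa β) ρ := by
    intro x hx0 hx1
    have := hβK _ (hρ.ac hA hx0 hx1)
    rwa [← pairH_opAC, pairH_opAC_poly, h0, mul_zero, zero_add] at this
  by_contra hT; rw [not_le] at hT
  set T := pairH q (opTa β) ρ with hTdef
  set W := pairH q (opWa β) ρ with hWdef
  by_cases hW : W ≤ 0
  · have := hg (1 / 2) (by norm_num) (by norm_num)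
    nlinarith
  · rw [not_le] at hW
    have hWT : 0 < W - T := by linarith
    set x : ℝ := -T / (2 * (W - T)) with hx
    have hx0 : 0 < x := by rw [hx]; exact div_pos (by linarith) (by linarith)
    have hx1 : x ≤ 1 / 2 := by rw [hx, div_le_iff₀ (by linarith)]; linarith
    have := hg x hx0.le (by linarith)
    have e : x * (1 - x) * T + x ^ 2 * W = x * (T + x * (W - T)) := by ring
    have e2 : x * (W - T) = -T / 2 := by rw [hx]; field_simp
    rw [e, e2] at this
    nlinarith

end ThreeApex

end FK

end Summit.CriticalPhenomena.PercolationContinuityZ3.Theorems
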